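import Mathlib
import Summits.HubbardSuperconductivity.HubbardSuperconductivity.Theses.BalabanIR

/-!
# Sketch — crux-ideate stmt-HubbardSuperconductivity-2081 (`BalabanIR.BirBdGPhaseCoercivity`), ideator 1

First lemmas of the two idea cards (they only need to ELABORATE; proofs are `sorry`):

* card `sqrt-concavity-multiplier` (Lever A): `traceNorm_le_am_gm` (operator AM–GM / tangent plane of the
  concave map `Q ↦ Tr √Q`), and the explicit Brillouin-zone MULTIPLIER INEQUALITY
  `SqrtTangentMultiplierBound μ Δ₁ Δ₂` to which the crux reduces (`multiplierBound_implies_crux`).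
* card `bcs-dual-persistence` (Lever B): `bach_trace_inequality` (T = 0 variational stability
  `Tr[H(Γ-P₋)] ≥ Tr[|H|(Γ-P₋)²]`), the engine of the persistence-of-translational-symmetry transfer, and the
  two-body Birman–Schwinger stability statement `BdGPairStability μ Δ₁ Δ₂ ε`.
-/

noncomputable section

set_option linter.dupNamespace false

namespace Summit.HubbardSuperconductivity.HubbardSuperconductivity.Cruxes.BirBdGPhaseCoercivity.Sketch

open scoped BigOperators Matrix ComplexOrder
open Real Finset Literature.Probability.LatticeModels

/-! ## Lever A -/

/-- **First lemma of card `sqrt-concavity-multiplier`** (operator AM–GM for the trace norm; the tangent plane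
of the concave map `Q ↦ Tr √Q` at `Q = B²`): for Hermitian `A` and positive definite `B`,
`Tr|A| ≤ ½ Tr B + ½ Tr (B⁻¹ A²)`, with equality iff `B = |A|`.
Proof sketch: Cauchy–Schwarz for the Frobenius form, `Tr|A| = Tr(B^{1/2} · B^{-1/2}|A|) ≤ (Tr B)^{1/2}(Tr B⁻¹A²)^{1/2}`. -/
theorem traceNorm_le_am_gm {n : Type*} [Fintype n] [DecidableEq n]
    (A B : Matrix n n ℂ) (hA : A.IsHermitian) (hB : B.PosDef) :
    ∑ i, |hA.eigenvalues i| ≤ (1 / 2) * ((B.trace).re + ((B⁻¹ * (A * A)).trace).re) := by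
  sorry

/-- momentum angle `2π k_i / L` of a torus index. -/
def ang (L : ℕ) (k : TorusSite 2 L) (i : Fin 2) : ℝ := 2 * π * ((k i).val : ℝ) / L

/-- band energy `ξ_p = -2 cos p₁ - 2 cos p₂ - μ`. -/
def xi (μ : ℝ) (L : ℕ) (p : TorusSite 2 L) : ℝ := -2 * Real.cos (ang L p 0) - 2 * Real.cos (ang L p 1) - μ

/-- chiral gap function `Δ_p = 2Δ₁(cos p₁ - cos p₂) - 4 i Δ₂ sin p₁ sin p₂` (symbol of `D(0)`). -/
def gap (Δ₁ Δ₂ : ℝ) (L : ℕ) (p : TorusSite 2 L) : ℂ :=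
  (2 * Δ₁ * (Real.cos (ang L p 0) - Real.cos (ang L p 1)) : ℝ) -
    Complex.I * (4 * Δ₂ * Real.sin (ang L p 0) * Real.sin (ang L p 1) : ℝ)

/-- quasiparticle energy `E_p = √(ξ_p² + |Δ_p|²)`. -/
def qpE (μ Δ₁ Δ₂ : ℝ) (L : ℕ) (p : TorusSite 2 L) : ℝ := Real.sqrt (xi μ L p ^ 2 + ‖gap Δ₁ Δ₂ L p‖ ^ 2)

/-- the tangent-certificate multiplier `m_L(k) = (4L²)⁻¹ Σ_p |Δ_p + Δ_{p+k}|² (1/E_p + 1/E_{p+k})`. -/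
def mult (μ Δ₁ Δ₂ : ℝ) (L : ℕ) [NeZero L] (k : TorusSite 2 L) : ℝ :=
  (4 * (L : ℝ) ^ 2)⁻¹ * ∑ p : TorusSite 2 L,
    ‖gap Δ₁ Δ₂ L p + gap Δ₁ Δ₂ L (p + k)‖ ^ 2 * ((qpE μ Δ₁ Δ₂ L p)⁻¹ + (qpE μ Δ₁ Δ₂ L (p + k))⁻¹)

/-- XY dispersion `ε(k) = 4 - 2cos k₁ - 2cos k₂`. -/
def epsXY (L : ℕ) (k : TorusSite 2 L) : ℝ := 4 - 2 * Real.cos (ang L k 0) - 2 * Real.cos (ang L k 1)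

/-- **The multiplier inequality** (Lever A's reduced form of the crux): for the given `(μ, Δ₁, Δ₂)` there are
`c₀ > 0`, `L₀` with `½ (m_L(0) - m_L(k)) ≥ c₀ ε(k)` for all `L ≥ L₀` and all momenta `k`. By the tangent bound
(`traceNorm_le_am_gm` with `B = |Hb(0)| = E ⊕ E`) and Parseval, it implies the crux's inequality at `(μ,Δ₁,Δ₂)`
with the same `c₀`. NUMERICS (folder numerics/bz2_L20.log): holds on `|μ| ≤ 3` for all tested `(Δ₁,Δ₂)`;
fails near the band edges `|μ| ≳ 3.5` (Fermi-surface log artefact), where the Doppler remainder is needed. -/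
def SqrtTangentMultiplierBound (μ Δ₁ Δ₂ : ℝ) : Prop :=
  ∃ c₀ : ℝ, 0 < c₀ ∧ ∃ L₀ : ℕ, ∀ (L : ℕ) [NeZero L], L₀ ≤ L →
    ∀ k : TorusSite 2 L, c₀ * epsXY L k ≤ (1 / 2) * (mult μ Δ₁ Δ₂ L 0 - mult μ Δ₁ Δ₂ L k)

/-- **Reduction** (the content of Lever A, to be proved): the multiplier inequality at every admissible
parameter triple implies the crux verbatim. -/
theorem multiplierBound_implies_crux
    (h : ∀ μ Δ₁ Δ₂ : ℝ, μ ∈ Set.Ioo (-4 : ℝ) 4 → Δ₁ ≠ 0 → Δ₂ ≠ 0 → SqrtTangentMultiplierBound μ Δ₁ Δ₂) :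
    Summit.HubbardSuperconductivity.HubbardSuperconductivity.Theses.BalabanIR.BirBdGPhaseCoercivity := by
  sorry

/-! ## Lever B -/

/-- **First lemma of card `bcs-dual-persistence`** (Bach's inequality, T = 0 variational stability): for a
Hermitian `H` with spectral decomposition `H = U diag(λ) U⋆`, `|H| := U diag|λ| U⋆`, negative spectral
projection `P₋ := U diag(𝟙[λ<0]) U⋆`, and any `0 ≤ Γ ≤ 1`:  `Tr[|H|(Γ - P₋)²] ≤ Tr[H(Γ - P₋)]`.
Proof sketch: `Γ² ≤ Γ` and `|H|` commutes with `P₋`. Applied to `H = Hb(C)` it turns the BCS functional's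
second variation into the GLOBAL bound `𝓕_V(Γ) - 𝓕_V(Γ_C) ≥ Σ (E_p+E_{p'})|δα_{pp'}|² - ⟨δα, V δα⟩`. -/
theorem bach_trace_inequality {n : Type*} [Fintype n] [DecidableEq n]
    (H Γ : Matrix n n ℂ) (hH : H.IsHermitian) (hΓ : Γ.PosSemidef) (hΓ' : (1 - Γ).PosSemidef) :
    let U : Matrix n n ℂ := (hH.eigenvectorUnitary : Matrix n n ℂ)
    let absH : Matrix n n ℂ := U * Matrix.diagonal (fun i => ((|hH.eigenvalues i| : ℝ) : ℂ)) * star U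
    let P : Matrix n n ℂ := U * Matrix.diagonal (fun i => if hH.eigenvalues i < 0 then (1 : ℂ) else 0) * star U
    ((absH * ((Γ - P) * (Γ - P))).trace).re ≤ ((H * (Γ - P)).trace).re := by
  sorry

/-- two-quasiparticle kernel `K_q(p) = E_p + E_{q-p}`. -/
def twoQP (μ Δ₁ Δ₂ : ℝ) (L : ℕ) (q p : TorusSite 2 L) : ℝ := qpE μ Δ₁ Δ₂ L p + qpE μ Δ₁ Δ₂ L (q - p)

/-- the six bond/channel form factors at centre-of-mass momentum `q` (index `a : Fin 6`:
`0 = B1g`, `1 = B2g`, `2..5` = the undirected bonds `e₁, e₂, e₁+e₂, e₁-e₂`), symmetrised in `p ↔ q-p`. -/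
def formFactor (L : ℕ) (q : TorusSite 2 L) (a : Fin 6) (p : TorusSite 2 L) : ℂ :=
  let φ₁ : TorusSite 2 L → ℂ := fun r => ((2 * (Real.cos (ang L r 0) - Real.cos (ang L r 1)) : ℝ) : ℂ)
  let φ₂ : TorusSite 2 L → ℂ := fun r => ((-4 * Real.sin (ang L r 0) * Real.sin (ang L r 1) : ℝ) : ℂ)
  let e : Fin 4 → (Fin 2 → ℤ) := ![![1, 0], ![0, 1], ![1, 1], ![1, -1]]
  let pw : (Fin 2 → ℤ) → TorusSite 2 L → ℂ := fun v r =>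
    Complex.exp (-Complex.I * ((v 0 : ℝ) * ang L r 0 + (v 1 : ℝ) * ang L r 1 : ℝ))
  match a with
  | ⟨0, _⟩ => (φ₁ (q - p) + φ₁ p) / 2
  | ⟨1, _⟩ => (φ₂ (q - p) + φ₂ p) / 2
  | ⟨j + 2, hj⟩ => (pw (e ⟨j, by omega⟩) (q - p) + pw (e ⟨j, by omega⟩) p) / 2

/-- **Transfer target `C⁺` of card `bcs-dual-persistence`** (Birman–Schwinger stability of the uniform
d+id BdG state for the tuned interaction `V = g₁ P_{B1g} + g₂ P_{B2g} + ε·1_bonds`): with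
`s₁ = ⟨2(cos p₁-cos p₂)²/E⟩`, `s₂ = ⟨8 sin²p₁ sin²p₂/E⟩`, `g₁ = 1/s₁ - ε/8 > 0`, `g₂ = 1/s₂ - ε/8 > 0`
(gap equation), the `6 × 6` matrices `M_q[a,b] = √(G_a G_b) L⁻² Σ_p conj(f_a(p)) f_b(p) / K_q(p)`,
`G = (g₁, g₂, ε, ε, ε, ε)`, satisfy `M_q ≤ 1` for every `q` and all large `L`. Via Bach's inequality and the
Hubbard–Stratonovich duality this gives the crux at `(μ,Δ₁,Δ₂)` with the explicit
`c₀ = min_k 8(a(0)†𝒱₀⁻¹a(0) - a(k)†𝒱_k⁻¹a(k))/ε(k) > 0` (NOTES.md §Lever B). -/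
def BdGPairStability (μ Δ₁ Δ₂ ε : ℝ) : Prop :=
  ∃ L₀ : ℕ, ∀ (L : ℕ) [NeZero L], L₀ ≤ L →
    let s₁ : ℝ := ((L : ℝ) ^ 2)⁻¹ * ∑ p : TorusSite 2 L,
      2 * (Real.cos (ang L p 0) - Real.cos (ang L p 1)) ^ 2 / qpE μ Δ₁ Δ₂ L p
    let s₂ : ℝ := ((L : ℝ) ^ 2)⁻¹ * ∑ p : TorusSite 2 L,
      8 * Real.sin (ang L p 0) ^ 2 * Real.sin (ang L p 1) ^ 2 / qpE μ Δ₁ Δ₂ L p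
    let G : Fin 6 → ℝ := ![1 / s₁ - ε / 8, 1 / s₂ - ε / 8, ε, ε, ε, ε]
    (0 < 1 / s₁ - ε / 8) ∧ (0 < 1 / s₂ - ε / 8) ∧
    ∀ q : TorusSite 2 L,
      let M : Matrix (Fin 6) (Fin 6) ℂ := fun a b =>
        (Real.sqrt (G a * G b) : ℂ) * ((L : ℂ) ^ 2)⁻¹ *
          ∑ p : TorusSite 2 L, (starRingEnd ℂ) (formFactor L q a p) * formFactor L q b p /
            (twoQP μ Δ₁ Δ₂ L q p : ℂ)
      (1 - M).PosSemidef

/-- **Reduction** (the content of Lever B, to be proved): stability for some `ε > 0` at every admissible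
parameter triple implies the crux. -/
theorem pairStability_implies_crux
    (h : ∀ μ Δ₁ Δ₂ : ℝ, μ ∈ Set.Ioo (-4 : ℝ) 4 → Δ₁ ≠ 0 → Δ₂ ≠ 0 → ∃ ε : ℝ, 0 < ε ∧ BdGPairStability μ Δ₁ Δ₂ ε) :
    Summit.HubbardSuperconductivity.HubbardSuperconductivity.Theses.BalabanIR.BirBdGPhaseCoercivity := by
  sorry

end Summit.HubbardSuperconductivity.HubbardSuperconductivity.Cruxes.BirBdGPhaseCoercivity.Sketch

end
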